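import Summits.HubbardSuperconductivity.HubbardSuperconductivity.Theses.ChiralWindow
import Literature.MathematicalPhysics.QuantumLattice.HubbardWave0LiebProofs
import Literature.MathematicalPhysics.QuantumLattice.FinDimSpectrumSectorGibbsLimit

/-!
# HubbardSuperconductivity / ChiralWindow — `CwEveryFromSomePenalised`

Route `ChiralWindow`, item `stmt-HubbardSuperconductivity-1745` (support): the two-line
variational ("slope monotonicity") lemma. With `H = hubbardTorus 2 L 1 U`, the d-wave pair
penalty `P = Δ_d† Δ_d` and `s > 0`: if `φ` is a normalised `(N, S^z = 0)`-sector ground state of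
`H + s • P` and `ψ` a normalised sector ground state of `H` in the same sector, then
`re ⟨φ, P φ⟩ ≤ re ⟨ψ, P ψ⟩`.

Proof: `E_s = re ⟨φ, (H + sP) φ⟩` and `E_0 = re ⟨ψ, H ψ⟩` (eigenvalue equations of
`IsGroundStateInSector`), while the sector energies are infima of Rayleigh quotients over unit
vectors of the sector (`minEnergyOn_le_rayleigh_of_mem`), so `E_s ≤ E_0 + s · re ⟨ψ, P ψ⟩` and
`E_0 ≤ E_s - s · re ⟨φ, P φ⟩`; add and divide by `s > 0`. Hermiticity of `H` and `H + sP` is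
used only to bound the Rayleigh sets from below.

Sources: T. A. Kaplan, P. Horsch, W. von der Linden, J. Phys. Soc. Jpn. 58 (1989) 3894 (variational
comparison of order parameters); R. B. Griffiths, J. Math. Phys. 5 (1964) 1215 (convexity /
slope monotonicity); H. Tasaki, *Physics and Mathematics of Quantum Many-Body Systems* (2020)
§2.2. [folklore]
-/

set_option linter.dupNamespace false

namespace Summit.HubbardSuperconductivity.HubbardSuperconductivity.Theorems

open Matrix Literature.MathematicalPhysics.QuantumLattice

/-- Abstract slope-monotonicity lemma: for Hermitian `H`, Hermitian `P`, real `s > 0` and a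
subspace `K`, if `φ ∈ K` is a unit eigenvector of `H + s • P` with eigenvalue the sector energy
`minEnergyOn (H + s • P) K` and `ψ ∈ K` is a unit eigenvector of `H` with eigenvalue
`minEnergyOn H K`, then `re ⟨φ, P φ⟩ ≤ re ⟨ψ, P ψ⟩`. Griffiths (1964); Tasaki (2020) §2.2.
[folklore] -/
theorem re_penalty_le_of_sector_groundStates {n : Type*} [Fintype n] [DecidableEq n]
    {H P : Matrix n n ℂ} (hH : H.IsHermitian) (hP : P.IsHermitian) {s : ℝ} (hs : 0 < s)
    (K : Submodule ℂ (n → ℂ)) {φ ψ : n → ℂ} (hφK : φ ∈ K) (hψK : ψ ∈ K)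
    (hφE : (H + (s : ℂ) • P) *ᵥ φ = (((H + (s : ℂ) • P).minEnergyOn K : ℝ) : ℂ) • φ)
    (hψE : H *ᵥ ψ = ((H.minEnergyOn K : ℝ) : ℂ) • ψ)
    (hφ1 : star φ ⬝ᵥ φ = 1) (hψ1 : star ψ ⬝ᵥ ψ = 1) :
    (star φ ⬝ᵥ P *ᵥ φ).re ≤ (star ψ ⬝ᵥ P *ᵥ ψ).re := by
  have hsP : ((s : ℂ) • P).IsHermitian := by
    unfold Matrix.IsHermitian
    rw [conjTranspose_smul, hP.eq, Complex.star_def, Complex.conj_ofReal]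
  have hHs : (H + (s : ℂ) • P).IsHermitian := hH.add hsP
  -- the two variational inequalities
  have h1 := minEnergyOn_le_rayleigh_of_mem hHs K hψK hψ1
  have h2 := minEnergyOn_le_rayleigh_of_mem hH K hφK hφ1
  -- evaluate the Rayleigh quotients through the eigenvalue equations
  have e1 : (star ψ ⬝ᵥ (H + (s : ℂ) • P) *ᵥ ψ).re =
      H.minEnergyOn K + s * (star ψ ⬝ᵥ P *ᵥ ψ).re := by
    rw [add_mulVec, dotProduct_add, smul_mulVec, dotProduct_smul, hψE, dotProduct_smul,
      hψ1]
    simp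
  have e2 : (star φ ⬝ᵥ H *ᵥ φ).re =
      (H + (s : ℂ) • P).minEnergyOn K - s * (star φ ⬝ᵥ P *ᵥ φ).re := by
    have hsplit : H *ᵥ φ = (H + (s : ℂ) • P) *ᵥ φ - ((s : ℂ) • P) *ᵥ φ := by
      rw [add_mulVec, add_sub_cancel_right]
    rw [hsplit, dotProduct_sub, hφE, smul_mulVec, dotProduct_smul, dotProduct_smul, hφ1]
    simp
  rw [e1] at h1
  rw [e2] at h2
  have h3 : s * (star φ ⬝ᵥ P *ᵥ φ).re ≤ s * (star ψ ⬝ᵥ P *ᵥ ψ).re := by linarith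
  exact le_of_mul_le_mul_left h3 hs

/-- **Item `stmt-HubbardSuperconductivity-1745`** (`ChiralWindow.CwEveryFromSomePenalised`): for
`s > 0`, every normalised `(N, S^z = 0)`-sector ground state `ψ` of `hubbardTorus 2 L 1 U` has
d-wave pair-field expectation `re ⟨ψ, Δ_d†Δ_d ψ⟩` at least that of any normalised sector ground
state `φ` of the penalised Hamiltonian `hubbardTorus 2 L 1 U + s • Δ_d†Δ_d`.
Kaplan–Horsch–von der Linden, J. Phys. Soc. Jpn. 58 (1989) 3894; Tasaki (2020) §2.2. [folklore] -/
theorem cwEveryFromSomePenalised_proof :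
    Summit.HubbardSuperconductivity.HubbardSuperconductivity.Theses.ChiralWindow.CwEveryFromSomePenalised := by
  unfold Summit.HubbardSuperconductivity.HubbardSuperconductivity.Theses.ChiralWindow.CwEveryFromSomePenalised
  intro L _ U s N φ ψ hs hφ hψ hφ1 hψ1
  obtain ⟨hφK, -, hφE⟩ := hφ
  obtain ⟨hψK, -, hψE⟩ := hψ
  unfold expect
  exact re_penalty_le_of_sector_groundStates
    (hubbardTorus_isHermitian (hamiltonian_isHermitian_and_commute_holds _) 1 U)
    (isHermitian_conjTranspose_mul_self _) hs (szSector N 0) hφK hψK hφE hψE hφ1 hψ1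

end Summit.HubbardSuperconductivity.HubbardSuperconductivity.Theorems
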